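import Summits.QuantumFields.YangMills.Theorems.HyperbolicRegulatorHyperbolicToTorusDefs

/-!
# Stub `stub_tracking` of the line `no_admissible_complex` (crux `HyperbolicToTorus`, stmt-QuantumFields-15827)

Registered stub TRACKING of the skeleton `Cruxes/HyperbolicToTorus/Lines/no_admissible_complex.lean` (v3): for a
`ℤ²`-chart `ψ` of radius `R ≥ 0` of a graph `Γ` on `ℕ` (`IsChart Γ R ψ`: injective on the box, lattice neighbours
adjacent, interior points certified) every walk `W` from the centre `ψ (0,0)` is tracked inside the chart for
`min (W.length, R)` steps (`ChartTracking Γ R ψ`).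

Proof (folklore, pure combinatorics): by induction on the prefix length `n ≤ min (W.length, R)` one builds a lattice
path `P` from `(0,0)` with unit steps and `W.getVert i = ψ (P i)`, `‖P i‖₁ ≤ i` for `i ≤ n`; at step `n → n+1` the point
`P n` has `‖P n‖₁ ≤ n ≤ R - 1`, so it is interior, hence certified, and the next vertex `W.getVert (n+1)` (a
`Γ`-neighbour of `ψ (P n)`) is the image of a lattice neighbour of `P n`, whose `ℓ¹`-norm is at most `n + 1`.
-/

set_option autoImplicit false

namespace Summit.QuantumFields.YangMills.Cruxes.HyperbolicToTorus.NoAdmissibleComplex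

open Finset

namespace StubTracking

/-- A unit step changes the `ℓ¹`-norm by at most one. -/
theorem norm_le_of_unitStep {a b : ℤ × ℤ} (h : UnitStep a b) : |b.1| + |b.2| ≤ |a.1| + |a.2| + 1 := by
  have h1 := abs_sub_abs_le_abs_sub b.1 a.1
  have h2 := abs_sub_abs_le_abs_sub b.2 a.2
  have h3 : |b.1 - a.1| + |b.2 - a.2| ≤ 1 := by
    rcases h with rfl | rfl | rfl | rfl <;> simp
  linarith

/-- A point of `ℓ¹`-norm at most `S` lies in the (sup-norm) box of radius `S`. -/
theorem inBox_of_norm_le {S : ℤ} {a : ℤ × ℤ} (h : |a.1| + |a.2| ≤ S) : InBox S a :=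
  ⟨le_trans (le_add_of_nonneg_right (abs_nonneg _)) h, le_trans (le_add_of_nonneg_left (abs_nonneg _)) h⟩

/-- **Prefix tracking.** In a chart of radius `R`, a walk `W` from the centre is, on every prefix of length
`n ≤ W.length` with `n ≤ R`, the image of a lattice path from `(0,0)` with unit steps and `‖P i‖₁ ≤ i`
(induction on `n`, using the certified-interior clause of `IsChart` at the point `P n`, which has `‖P n‖₁ ≤ n ≤ R - 1`). -/
theorem track_prefix {Γ : SimpleGraph ℕ} {R : ℤ} {ψ : ℤ × ℤ → ℕ} (hC : IsChart Γ R ψ) {x₀ u : ℕ}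
    (W : Γ.Walk x₀ u) (hx₀ : x₀ = ψ (0, 0)) :
    ∀ n : ℕ, n ≤ W.length → (n : ℤ) ≤ R →
      ∃ P : ℕ → ℤ × ℤ, P 0 = (0, 0) ∧ (∀ i : ℕ, i < n → UnitStep (P i) (P (i + 1))) ∧
        ∀ i : ℕ, i ≤ n → W.getVert i = ψ (P i) ∧ |(P i).1| + |(P i).2| ≤ i := by
  intro n
  induction n with
  | zero =>
    intro _ _
    refine ⟨fun _ => (0, 0), rfl, fun i hi => absurd hi (Nat.not_lt_zero _), fun i hi => ?_⟩
    obtain rfl := Nat.le_zero.mp hi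
    simp [W.getVert_zero, hx₀]
  | succ n ih =>
    intro hlen hR
    push_cast at hR
    obtain ⟨P, hP0, hstep, hvert⟩ := ih (Nat.le_of_succ_le hlen) (by omega)
    have hn := hvert n le_rfl
    have hbox : InBox (R - 1) (P n) :=
      inBox_of_norm_le (hn.2.trans (by omega))
    have hadj : Γ.Adj (ψ (P n)) (W.getVert (n + 1)) := by
      have h := W.adj_getVert_succ (i := n) (by omega)
      rwa [hn.1] at h
    obtain ⟨b, hb, hwb⟩ := hC.2.2 (P n) hbox _ hadj
    refine ⟨fun i => if i ≤ n then P i else b, by simp [hP0], fun i hi => ?_, fun i hi => ?_⟩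
    · rcases Nat.lt_succ_iff_lt_or_eq.mp hi with h | rfl
      · have h1 : i ≤ n := h.le
        have h2 : i + 1 ≤ n := h
        simp only [if_pos h1, if_pos h2]
        exact hstep i h
      · simp only [if_pos le_rfl, if_neg (Nat.not_succ_le_self i)]
        exact hb
    · rcases Nat.of_le_succ hi with h | rfl
      · simp only [if_pos h]
        exact hvert i h
      · simp only [if_neg (Nat.not_succ_le_self n)]
        refine ⟨hwb, ?_⟩
        have h := norm_le_of_unitStep hb
        push_cast
        linarith [hn.2]

end StubTracking

/-- **Registered stub TRACKING** of the line `no_admissible_complex` (v3): a chart of radius `R ≥ 0` tracks every walk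
from its centre for `min (W.length, R)` steps (`IsChart Γ R ψ → ChartTracking Γ R ψ`). Apply
`StubTracking.track_prefix` to the prefix length `n := min W.length R.toNat`; the indices `i` in `ChartTracking` with
`i < W.length`, `(i:ℤ) < R` (resp. `i ≤ W.length`, `(i:ℤ) ≤ R`) satisfy `i < n` (resp. `i ≤ n`). -/
theorem stub_tracking :
    ∀ (Γ : SimpleGraph ℕ) (R : ℤ) (ψ : ℤ × ℤ → ℕ), 0 ≤ R → IsChart Γ R ψ → ChartTracking Γ R ψ := by
  intro Γ R ψ hR hC x₀ u W hx₀
  have hRn : ((R.toNat : ℕ) : ℤ) = R := Int.toNat_of_nonneg hR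
  obtain ⟨P, hP0, hstep, hvert⟩ :=
    StubTracking.track_prefix hC W hx₀ (min W.length R.toNat) (min_le_left _ _) (by push_cast; omega)
  refine ⟨P, hP0, fun i hi hiR => hstep i ?_, fun i hi hiR => hvert i ?_⟩
  · omega
  · omega

end Summit.QuantumFields.YangMills.Cruxes.HyperbolicToTorus.NoAdmissibleComplex
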